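import Summits.KontsevichZagierPeriods.KontsevichZagierPeriods.Theorems.SoloInformedKZPOneKCharts
import HarnessLib
import HarnessLib.Audit

/-!
# SoloInformed — the power substitution `x = t^m` and the period conjecture for integrands rational in `x^{1/m}`

Solo programme `solo-KontsevichZagierPeriods-informed`, session s112, file 24.

The map `Φ_m(t) = t^m` on the half-line `t ≥ 0` is polynomial (hence `ℚ`-semialgebraic),
injective, with derivative `m t^{m-1} · id`; for any integral representation `R = [D, f]` of
dimension `1` with `D ⊆ [0, ∞)` the pulled-back representation
`R' = [ {t ≥ 0 : t^m ∈ D}, f(t^m) · m t^{m-1} ]` is a representation and `[R'] − [R]` is ONE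
change-of-variables move (rule (2); `soloInformed_exists_powSubst`).  If `f(x) = P(x^{1/m})/Q(x^{1/m})`
on `D` with `P, Q ∈ K[X]`, `K = algebraicClosure ℚ ℝ`, `Q(x^{1/m}) ≠ 0` on `D`
(`SoloInformedIsKRadicalOne m`), then `R'` has integrand `P(t) m t^{m-1} / Q(t)`: it belongs to the
`K`-rational class of file 17 and therefore to the span of points and segments (file 18, any
domain).  Consequence (`soloInformed_kzp_isKRadicalOne`): **the Kontsevich–Zagier period conjecture
holds between any two absolutely convergent integrals `∫_D P(x^{1/m})/Q(x^{1/m}) dx`,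
`∫_{D'} P'(x^{1/m'})/Q'(x^{1/m'}) dx` with real algebraic coefficients (`D, D' ⊆ [0,∞)`
`ℚ`-semialgebraic, any `m, m' ≥ 1`), and between these and the `K`-rational / rational
representations of dimension `≤ 1`, whenever the values agree.**  Examples: `∫₀¹ √x/(1+x) dx = 2 − π/2`,
`∫₀¹ dx/(1 + x^{1/3})`.

References: M. Kontsevich, D. Zagier, *Periods* (2001), §1.1 (integrality of algebraic functions
can be traded for rationality by more variables — here instead by one substitution), §1.2 rule (2);
A. Baker (1975), Thm. 2.1.
-/

noncomputable section

open scoped BigOperators Polynomial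

namespace Summit.KontsevichZagierPeriods.KontsevichZagierPeriods.Theorems

open Set MeasureTheory
open Literature.ModelTheory.ExponentialFields
open Literature.NumberTheory.Transcendental Literature.NumberTheory.Transcendental.KZ

/-! ## The power map -/

/-- The power map `t ↦ t^m` of the line, in the coordinates `Fin 1 → ℝ`. -/
def soloInformedPowSubstMap (m : ℕ) : (Fin 1 → ℝ) → (Fin 1 → ℝ) := fun w _ => (w 0) ^ m

/-- The derivative of the power map at `w`: `(m · (w 0)^{m-1}) • id`. -/
def soloInformedPowSubstDeriv (m : ℕ) (w : Fin 1 → ℝ) : (Fin 1 → ℝ) →L[ℝ] (Fin 1 → ℝ) :=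
  ((m : ℝ) * (w 0) ^ (m - 1)) • ContinuousLinearMap.id ℝ (Fin 1 → ℝ)

/-- Pointwise formula. -/
@[simp] theorem soloInformed_powSubstMap_apply (m : ℕ) (w : Fin 1 → ℝ) (i : Fin 1) :
    soloInformedPowSubstMap m w i = (w 0) ^ m := rfl

/-- The power map is the polynomial map `X₀^m`. -/
theorem soloInformed_powSubstMap_eq_aeval (m : ℕ) : soloInformedPowSubstMap m =
    fun (x : Fin 1 → ℝ) (_ : Fin 1) =>
      (MvPolynomial.aeval x (MvPolynomial.X 0 ^ m : MvPolynomial (Fin 1) ℚ) : ℝ) := by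
  funext x j
  simp [soloInformedPowSubstMap]

/-- The power map is differentiable with the stated derivative. -/
theorem soloInformed_hasFDerivAt_powSubstMap (m : ℕ) (w : Fin 1 → ℝ) :
    HasFDerivAt (soloInformedPowSubstMap m) (soloInformedPowSubstDeriv m w) w := by
  rw [hasFDerivAt_pi']
  intro i
  have h1 : HasFDerivAt (fun w : Fin 1 → ℝ => w 0)
      (ContinuousLinearMap.proj (R := ℝ) (φ := fun _ : Fin 1 => ℝ) 0) w :=
    (ContinuousLinearMap.proj (R := ℝ) (φ := fun _ : Fin 1 => ℝ) 0).hasFDerivAt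
  have h2 := (hasDerivAt_pow m (w 0)).comp_hasFDerivAt w h1
  refine h2.congr_fderiv ?_
  ext v
  simp [soloInformedPowSubstDeriv, Fin.fin_one_eq_zero i]

/-- The Jacobian determinant of the power map: `m (w 0)^{m-1}`. -/
theorem soloInformed_det_powSubstDeriv (m : ℕ) (w : Fin 1 → ℝ) :
    (soloInformedPowSubstDeriv m w).det = (m : ℝ) * (w 0) ^ (m - 1) := by
  unfold soloInformedPowSubstDeriv
  rw [ContinuousLinearMap.det, ContinuousLinearMap.toLinearMap_smul, ContinuousLinearMap.coe_id,
    LinearMap.det_smul, LinearMap.det_id, Module.finrank_fin_fun]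
  simp

/-- The power map is `ℚ`-semialgebraic on every `ℚ`-semialgebraic set. -/
theorem soloInformed_isSemialgebraicMapOn_powSubstMap (m : ℕ) {s : Set (Fin 1 → ℝ)}
    (hs : IsSemialgebraic ℚ s) : IsSemialgebraicMapOn ℚ s (soloInformedPowSubstMap m) := by
  rw [soloInformed_powSubstMap_eq_aeval]
  exact isSemialgebraicMapOn_aeval hs fun _ => MvPolynomial.X 0 ^ m

/-- Preimages of `ℚ`-semialgebraic sets under the power map are `ℚ`-semialgebraic. -/
theorem soloInformed_isSemialgebraic_preimage_powSubstMap (m : ℕ) {s : Set (Fin 1 → ℝ)}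
    (hs : IsSemialgebraic ℚ s) : IsSemialgebraic ℚ (soloInformedPowSubstMap m ⁻¹' s) := by
  rw [soloInformed_powSubstMap_eq_aeval]
  exact hs.preimage_aeval fun _ => MvPolynomial.X 0 ^ m

/-- The power map (`m ≠ 0`) is injective on the closed half-line `{t | 0 ≤ t 0}`. -/
theorem soloInformed_injOn_powSubstMap {m : ℕ} (hm : m ≠ 0) {s : Set (Fin 1 → ℝ)}
    (hs : ∀ w ∈ s, 0 ≤ w 0) : InjOn (soloInformedPowSubstMap m) s := by
  intro a ha b hb h
  have h0 : (a 0) ^ m = (b 0) ^ m := congr_fun h 0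
  have hab : a 0 = b 0 := (pow_left_inj₀ (hs a ha) (hs b hb) hm).1 h0
  rw [KZ.eq_const_apply_zero a, KZ.eq_const_apply_zero b, hab]

/-- The power map (`m ≠ 0`) maps `{t ≥ 0 | t^m ∈ D}` ONTO `D` when `D ⊆ [0, ∞)`. -/
theorem soloInformed_powSubstMap_image {m : ℕ} (hm : m ≠ 0) {D : Set (Fin 1 → ℝ)}
    (hD : ∀ x ∈ D, 0 ≤ x 0) :
    soloInformedPowSubstMap m '' {t | t ∈ soloInformedPowSubstMap m ⁻¹' D ∧ 0 ≤ t 0} = D := by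
  ext x
  constructor
  · rintro ⟨t, ht, rfl⟩
    exact ht.1
  · intro hx
    have hx0 := hD x hx
    have hpt : soloInformedPowSubstMap m (fun _ => (x 0) ^ ((m : ℝ)⁻¹)) = x := by
      funext i
      rw [soloInformed_powSubstMap_apply, Real.rpow_inv_natCast_pow hx0 hm, Fin.fin_one_eq_zero i]
    refine ⟨fun _ => (x 0) ^ ((m : ℝ)⁻¹), ⟨?_, Real.rpow_nonneg hx0 _⟩, hpt⟩
    show soloInformedPowSubstMap m (fun _ => (x 0) ^ ((m : ℝ)⁻¹)) ∈ D
    rw [hpt]; exact hx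

/-! ## The power substitution move -/

/-- **The power substitution `x = t^m` is one change-of-variables move.** For `R = [D, f]` of
dimension `1` with `D ⊆ [0, ∞)` and `m ≠ 0` there is a representation
`R' = [ {t ≥ 0 | t^m ∈ D}, f(t^m) · |m t^{m-1}| ]` with `[R'] − [R] ∈ changeOfVariablesRel`.
[Kontsevich–Zagier 2001, §1.2 rule (2)] -/
theorem soloInformed_exists_powSubst {m : ℕ} (hm : m ≠ 0) (R : IntegralRep 1)
    (hD : ∀ x ∈ R.domain, 0 ≤ x 0) :
    ∃ R' : IntegralRep 1, R'.domain = {t | t ∈ soloInformedPowSubstMap m ⁻¹' R.domain ∧ 0 ≤ t 0} ∧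
      (R'.integrand = fun t => R.integrand (soloInformedPowSubstMap m t) *
        |(soloInformedPowSubstDeriv m t).det|) ∧
      of R' - of R ∈ changeOfVariablesRel := by
  set S : Set (Fin 1 → ℝ) := {t | t ∈ soloInformedPowSubstMap m ⁻¹' R.domain ∧ 0 ≤ t 0} with hSdef
  have hS : IsSemialgebraic ℚ S :=
    IsSemialgebraicFunOn.isSemialgebraic_sep_nonneg
      (Literature.NumberTheory.Transcendental.isSemialgebraicFunOn_apply
        (soloInformed_isSemialgebraic_preimage_powSubstMap m R.isSemialgebraic_domain) 0)
  have hS0 : ∀ t ∈ S, 0 ≤ t 0 := fun t ht => ht.2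
  have hmaps : ∀ t ∈ S, soloInformedPowSubstMap m t ∈ R.domain := fun t ht => ht.1
  have hΦ : IsSemialgebraicMapOn ℚ S (soloInformedPowSubstMap m) :=
    soloInformed_isSemialgebraicMapOn_powSubstMap m hS
  have hderiv : ∀ t ∈ S, HasFDerivWithinAt (soloInformedPowSubstMap m) (soloInformedPowSubstDeriv m t) S t :=
    fun t _ => (soloInformed_hasFDerivAt_powSubstMap m t).hasFDerivWithinAt
  have hinj : InjOn (soloInformedPowSubstMap m) S := soloInformed_injOn_powSubstMap hm hS0
  have himage : soloInformedPowSubstMap m '' S = R.domain := soloInformed_powSubstMap_image hm hD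
  -- semialgebraicity of the new integrand (on `S` the Jacobian is the polynomial `m t^{m-1}`)
  have hjac : IsSemialgebraicFunOn ℚ S (fun t => |(soloInformedPowSubstDeriv m t).det|) := by
    refine (isSemialgebraicFunOn_aeval_div_aeval hS
      (MvPolynomial.C (m : ℚ) * MvPolynomial.X 0 ^ (m - 1)) (1 : MvPolynomial (Fin 1) ℚ)
      fun v _ => by simp).congr fun t ht => ?_
    show (MvPolynomial.aeval t (MvPolynomial.C (m : ℚ) * MvPolynomial.X 0 ^ (m - 1) :
        MvPolynomial (Fin 1) ℚ) : ℝ) / MvPolynomial.aeval t (1 : MvPolynomial (Fin 1) ℚ) =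
      |(soloInformedPowSubstDeriv m t).det|
    rw [soloInformed_det_powSubstDeriv, abs_of_nonneg (by have := hS0 t ht; positivity)]
    simp
  have hfun : IsSemialgebraicFunOn ℚ S (fun t => R.integrand (soloInformedPowSubstMap m t) *
      |(soloInformedPowSubstDeriv m t).det|) :=
    (IsSemialgebraicFunOn.mul_holds
      (IsSemialgebraicFunOn.comp_isSemialgebraicMapOn_holds R.isSemialgebraicFunOn_integrand hΦ
        hmaps) hjac).congr fun _ _ => rfl
  -- absolute convergence of the pulled-back integral
  have hint : IntegrableOn (fun t => R.integrand (soloInformedPowSubstMap m t) *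
      |(soloInformedPowSubstDeriv m t).det|) S := by
    have h := (integrableOn_image_iff_integrableOn_abs_det_fderiv_smul volume
      (IsSemialgebraic.measurableSet_holds hS) hderiv hinj R.integrand).1 (by
        rw [himage]; exact R.integrableOn)
    refine h.congr_fun (fun t _ => ?_) (IsSemialgebraic.measurableSet_holds hS)
    show |(soloInformedPowSubstDeriv m t).det| • R.integrand (soloInformedPowSubstMap m t) = _
    rw [smul_eq_mul, mul_comm]
  refine ⟨⟨S, _, hS, hfun, hint⟩, rfl, rfl, ?_⟩
  exact ⟨1, ⟨S, _, hS, hfun, hint⟩, R, soloInformedPowSubstMap m, soloInformedPowSubstDeriv m, hΦ, hderiv,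
    hinj, himage.symm, fun t _ => rfl, rfl⟩

/-! ## The class of integrands rational in `x^{1/m}` -/

/-- `r = [D, f]` of dimension `1` has `D ⊆ [0, ∞)` and integrand `P(x^{1/m})/Q(x^{1/m})` on `D` for
some `P, Q ∈ K[X]` (`K = algebraicClosure ℚ ℝ`) with `Q(x^{1/m}) ≠ 0` on `D`. -/
def SoloInformedIsKRadicalOne (m : ℕ) (r : IntegralRep 1) : Prop :=
  ∃ P Q : (algebraicClosure ℚ ℝ)[X],
    (∀ x ∈ r.domain, 0 ≤ x 0 ∧ (Polynomial.aeval ((x 0) ^ ((m : ℝ)⁻¹)) Q : ℝ) ≠ 0) ∧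
    EqOn r.integrand (fun x => (Polynomial.aeval ((x 0) ^ ((m : ℝ)⁻¹)) P : ℝ) /
      Polynomial.aeval ((x 0) ^ ((m : ℝ)⁻¹)) Q) r.domain

/-- `K`-rational representations on `D ⊆ [0, ∞)` are in the class with `m = 1`. -/
theorem soloInformed_isKRadicalOne_one (r : IntegralRep 1) (hr : SoloInformedIsKRationalOne r)
    (hD : ∀ x ∈ r.domain, 0 ≤ x 0) : SoloInformedIsKRadicalOne 1 r := by
  obtain ⟨P, Q, hq, hpq⟩ := hr
  refine ⟨P, Q, fun x hx => ⟨hD x hx, ?_⟩, fun x hx => ?_⟩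
  · rw [Nat.cast_one, inv_one, Real.rpow_one]; exact hq x hx
  · rw [hpq hx]
    simp only [Nat.cast_one, inv_one, Real.rpow_one]

/-- **After the power substitution the integrand is `K`-rational**: the pulled-back
representation `R'` of a member of the class is in `SoloInformedIsKRationalOne`, with integrand
`P(t) · m t^{m-1} / Q(t)`. -/
theorem soloInformed_isKRationalOne_powSubst {m : ℕ} (hm : m ≠ 0) (r : IntegralRep 1)
    (hr : SoloInformedIsKRadicalOne m r) (R' : IntegralRep 1)
    (hdom : R'.domain = {t | t ∈ soloInformedPowSubstMap m ⁻¹' r.domain ∧ 0 ≤ t 0})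
    (hint : R'.integrand = fun t => r.integrand (soloInformedPowSubstMap m t) *
      |(soloInformedPowSubstDeriv m t).det|) : SoloInformedIsKRationalOne R' := by
  obtain ⟨P, Q, hq, hpq⟩ := hr
  have hmem : ∀ t ∈ R'.domain, soloInformedPowSubstMap m t ∈ r.domain ∧ 0 ≤ t 0 := fun t ht => by
    rw [hdom] at ht; exact ht
  have hroot : ∀ t : Fin 1 → ℝ, 0 ≤ t 0 → ((soloInformedPowSubstMap m t) 0) ^ ((m : ℝ)⁻¹) = t 0 :=
    fun t ht => by rw [soloInformed_powSubstMap_apply, Real.pow_rpow_inv_natCast ht hm]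
  refine ⟨P * (Polynomial.C ((m : ℕ) : algebraicClosure ℚ ℝ) * Polynomial.X ^ (m - 1)), Q,
    fun t ht => ?_, fun t ht => ?_⟩
  · obtain ⟨hx, ht0⟩ := hmem t ht
    have h := (hq _ hx).2
    rwa [hroot t ht0] at h
  · obtain ⟨hx, ht0⟩ := hmem t ht
    rw [hint]
    show r.integrand (soloInformedPowSubstMap m t) * |(soloInformedPowSubstDeriv m t).det| = _
    rw [hpq hx, soloInformed_det_powSubstDeriv, abs_of_nonneg (by positivity)]
    show (Polynomial.aeval (((soloInformedPowSubstMap m t) 0) ^ ((m : ℝ)⁻¹)) P : ℝ) /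
        Polynomial.aeval (((soloInformedPowSubstMap m t) 0) ^ ((m : ℝ)⁻¹)) Q * ((m : ℝ) * (t 0) ^ (m - 1)) =
      (Polynomial.aeval (t 0) (P * (Polynomial.C ((m : ℕ) : algebraicClosure ℚ ℝ) *
        Polynomial.X ^ (m - 1))) : ℝ) / Polynomial.aeval (t 0) Q
    rw [hroot t ht0, map_mul, map_mul, map_pow, Polynomial.aeval_X, Polynomial.aeval_C, map_natCast]
    ring

/-- **Members of the radical class lie in the span of points and segments** (one power
substitution, then file 18). -/
theorem soloInformed_segSpan_of_isKRadicalOne {m : ℕ} (hm : m ≠ 0) (r : IntegralRep 1)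
    (hr : SoloInformedIsKRadicalOne m r) : of r ∈ soloInformedSegSpan := by
  obtain ⟨P, Q, hq, hpq⟩ := hr
  obtain ⟨R', hdom, hint, hrel⟩ := soloInformed_exists_powSubst hm r fun x hx => (hq x hx).1
  have hR' : SoloInformedIsKRationalOne R' :=
    soloInformed_isKRationalOne_powSubst hm r ⟨P, Q, hq, hpq⟩ R' hdom hint
  have h1 : of r - of R' ∈ relations := by
    have h := relations.neg_mem (changeOfVariablesRel_subset_relations hrel)
    rwa [neg_sub] at h
  exact soloInformed_mem_segSpan_of_sub_mem h1 (soloInformed_segSpan_of_isKRationalOne R' hR')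

/-- **The Kontsevich–Zagier period conjecture for one-variable integrands rational in `x^{1/m}`
with real algebraic coefficients** (unconditional; `D, D' ⊆ [0, ∞)` `ℚ`-semialgebraic, any
`m, m' ≥ 1`): equal values ⇒ KZ-equivalent; likewise against the `K`-rational class of dimension
`1` and against rational representations of dimension `≤ 1`.
[Kontsevich–Zagier 2001, §1.2 Question 1; this work] -/
theorem soloInformed_kzp_isKRadicalOne {m m' : ℕ} (hm : m ≠ 0) (hm' : m' ≠ 0)
    (r r' : IntegralRep 1) (hr : SoloInformedIsKRadicalOne m r)
    (hr' : SoloInformedIsKRadicalOne m' r') :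
    (r.value = r'.value → Equivalent r r') ∧
    (∀ r₁ : IntegralRep 1, SoloInformedIsKRationalOne r₁ → r.value = r₁.value → Equivalent r r₁) ∧
    (∀ {n : ℕ} (hn : n ≤ 1) (r₀ : IntegralRep n), r₀.IsRational → r.value = r₀.value →
      Equivalent r r₀) := by
  have h := soloInformed_segSpan_of_isKRadicalOne hm r hr
  exact ⟨fun hv => soloInformed_equivalent_of_mem_segSpan h
      (soloInformed_segSpan_of_isKRadicalOne hm' r' hr') hv,
    fun r₁ hr₁ hv => soloInformed_equivalent_of_mem_segSpan h
      (soloInformed_segSpan_of_isKRationalOne r₁ hr₁) hv,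
    fun hn r₀ hr₀ hv => soloInformed_equivalent_of_mem_segSpan h
      (soloInformed_of_mem_segSpan_of_isRational hn r₀ hr₀) hv⟩

/-- Kernel form: a member of the radical class with value `0` is a relation. -/
theorem soloInformed_mem_relations_of_value_eq_zero_radical {m : ℕ} (hm : m ≠ 0)
    (r : IntegralRep 1) (hr : SoloInformedIsKRadicalOne m r) (h0 : r.value = 0) :
    of r ∈ relations :=
  soloInformed_mem_relations_of_mem_segSpan (soloInformed_segSpan_of_isKRadicalOne hm r hr)
    (by rw [eval_of]; exact h0)

end Summit.KontsevichZagierPeriods.KontsevichZagierPeriods.Theorems
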